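import Literature.Probability.RandomPlanarGeometry.HexSAWStripBetaLengthLaw
import Mathlib.Analysis.Normed.Group.Tannery
import HarnessLib

/-!
# The head and tail masses of the two β-laws coincide: `Fℓ_c = F_c`, `Gℓ_e = G_e` — the contact amplitude `Λ_T` and the length amplitude `Λℓ_T`
# live on the SAME head/tail factors (module «BETA-HEAD-TAIL-MASSES»)

Topic `Literature/Probability/RandomPlanarGeometry` (continues «BETA-COEFF» #495 `HexSAWStripBetaCoefficientLaw.lean` — the contact-graded head/tail series
`HV.headGF T c = Σ_i f_c(i) y_T^i`, `HV.tailGF`, `HV.headCoeffN_le_tendsto`, `HV.summable_headCoeff_mul_pow`, the contact law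
`HV.exists_tendsto_stripBcoeff_mul_pow` with amplitude `(2ρ/y_T)(Σ_a F_a u_a)(Σ_b ℓ_b G_b)` —, «BETA-LENGTH-SPLIT» #578 (`HV.headLenGF T c = Σ_i fℓ_c(i)(y_T)`,
`HV.tendsto_headGFN_headLenGF : F^{(N)}_c(y_T) → Fℓ_c`) and «BETA-LENGTH-LAW» #586 (`HV.exists_tendsto_betaLenSum_even` with amplitude
`4ρ′(Σ_a Fℓ_a u′_a)(Σ_b ℓ′_b Gℓ_b)`)).  Lane «pcv-sawmu», a-p2 g22 — a consolidation rider.  Sources of the SETTING: N. R. Beaton et al., CMP 326 (2014)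
§3.2, Corollary 8; H. Duminil-Copin, A. Hammond, CMP 324 (2013) §2.2.  Nothing printed.

## What is proved (namespace `Literature.Probability.RandomPlanarGeometry.SAW.HV`, `T ≥ 2`)

* `headGFN_eq_sum_headCoeffN` / `tailGFN_eq_sum_tailCoeffN` — the truncated series regrouped by contacts (finite sums);
* ★ `tendsto_headGFN_headGF` / `tendsto_tailGFN_tailGF` — `F^{(N)}_c(y_T) → F_c = HV.headGF T c`, `G^{(N)}_e(y_T) → G_e` (Tannery over the contact index);
* ★★ `headLenGF_eq_headGF`, `tailLenGF_eq_tailGF` — `Fℓ_c = F_c`, `Gℓ_e = G_e`: both are the total `x_c^{|h|} y_T^{#top}`-mass of the heads (tails);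
* ★★ `exists_tendsto_betaLenSum_even_headGF` — the length law with its amplitude written on the contact-law masses:
  `bℓ_T(2m)(y_T) → 4ρ′ (Σ_a F_a u′_a)(Σ_b ℓ′_b G_b)`, next to `β_{T,m} y_T^m → (2ρ/y_T)(Σ_a F_a u_a)(Σ_b ℓ_b G_b)` (#495): the two amplitudes differ ONLY
  through the bridge residue data (`y`-side `(u, ℓ, ρ)` vs `x`-side `(u′, ℓ′, ρ′)`), not through the end pieces.

Label: LANE COROLLARY (own, a-p2 g22, 2026-08-26).  NOT claimed: any relation between `(u, ℓ, ρ)` and `(u′, ℓ′, ρ′)`.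
-/

noncomputable section

open Finset Filter Topology Literature.Probability.LatticeModels Literature.Probability.Percolation

namespace Literature.Probability.RandomPlanarGeometry.SAW.HV

variable {T : ℕ}

/-- `F^{(N)}_c(y) = Σ_{i ≤ N+1} f^{(N)}_c(i) y^i` — regrouping the truncated head class by the number of contacts (a head with at most `N + 1` vertices has
at most `N + 1` contacts). [cite: BeatonBousquetMelouDeGierDuminilCopinGuttmann2014, §3.2; lane plumbing] -/
theorem headGFN_eq_sum_headCoeffN (N : ℕ) (c : ℤ) (y : ℝ) :
    headGFN T N c y = ∑ i ∈ Finset.range (N + 2), headCoeffN T N i c * y ^ i := by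
  classical
  rw [headGFN, ← Finset.sum_fiberwise_of_maps_to (g := topCnt T) (t := Finset.range (N + 2)) (fun h hh => by
    obtain ⟨-, -, hlen, -⟩ := of_mem_headN hh
    rw [mem_range]; have := topCnt_le_length T h; omega)]
  refine sum_congr rfl fun i _ => ?_
  rw [headCoeffN, sum_mul]
  refine sum_congr rfl fun h hh => ?_
  rw [(mem_filter.1 hh).2]

/-- `G^{(N)}_e(y) = Σ_{k ≤ N+1} g^{(N)}_e(k) y^k`. [cite: BeatonBousquetMelouDeGierDuminilCopinGuttmann2014, §3.2; lane plumbing] -/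
theorem tailGFN_eq_sum_tailCoeffN (N : ℕ) (e : ℤ) (y : ℝ) :
    tailGFN T N e y = ∑ k ∈ Finset.range (N + 2), tailCoeffN T N k e * y ^ k := by
  classical
  rw [tailGFN, ← Finset.sum_fiberwise_of_maps_to (g := fun g => topCnt T g.tail) (t := Finset.range (N + 2)) (fun g hg => by
    obtain ⟨-, -, hlen, -⟩ := of_mem_tailN hg
    rw [mem_range]; have := topCnt_le_length T g.tail; have := g.length_tail; omega)]
  refine sum_congr rfl fun k _ => ?_
  rw [tailCoeffN, sum_mul]
  refine sum_congr rfl fun g hg => ?_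
  rw [wD, (mem_filter.1 hg).2]

/-- Beyond `N + 1` contacts the truncated head / tail coefficients vanish (plumbing). [cite: BeatonBousquetMelouDeGierDuminilCopinGuttmann2014, §3.2; lane plumbing] -/
theorem headCoeffN_eq_zero_of_lt {N i : ℕ} (hi : N + 2 ≤ i) (c e : ℤ) : headCoeffN T N i c = 0 ∧ tailCoeffN T N i e = 0 := by
  constructor
  · rw [headCoeffN]
    refine sum_eq_zero fun h hh => ?_
    rw [mem_filter] at hh
    obtain ⟨-, -, hlen, -⟩ := of_mem_headN hh.1
    have := topCnt_le_length T h
    omega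
  · rw [tailCoeffN]
    refine sum_eq_zero fun g hg => ?_
    rw [mem_filter] at hg
    obtain ⟨-, -, hlen, -⟩ := of_mem_tailN hg.1
    have := topCnt_le_length T g.tail
    have := g.length_tail
    omega

/-- ★ **The truncated head series converge to the contact-graded head series**: `F^{(N)}_c(y_T) → F_c = HV.headGF T c` (`T ≥ 2`; Tannery over the
contact index, dominated by `f_c(i) y_T^i`, summable by #495). [cite: BeatonBousquetMelouDeGierDuminilCopinGuttmann2014, §3.2 and Corollary 8; lane «pcv-sawmu» a-p2 g22] -/
theorem tendsto_headGFN_headGF (hT : 2 ≤ T) (c : ℤ) : Tendsto (fun N => headGFN T N c (stripYT T)) atTop (𝓝 (headGF T c)) := by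
  have hy : 0 ≤ stripYT T := (one_lt_stripYT (by omega : 1 ≤ T)).le.trans' zero_le_one
  obtain ⟨hsum, -⟩ := summable_headCoeff_mul_pow hT c
  have hlim := tendsto_tsum_of_dominated_convergence (𝓕 := atTop) (β := ℕ)
    (f := fun (N i : ℕ) => headCoeffN T N i c * stripYT T ^ i) (g := fun i => headCoeff T i c * stripYT T ^ i)
    (bound := fun i => headCoeff T i c * stripYT T ^ i) hsum
    (fun i => ((headCoeffN_le_tendsto hT i c).2.2).mul_const _)
    (Eventually.of_forall fun N i => by
      rw [Real.norm_eq_abs, abs_of_nonneg (mul_nonneg (pieceCoeffN_nonneg N i c c).1 (pow_nonneg hy _))]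
      exact mul_le_mul_of_nonneg_right ((headCoeffN_le_tendsto hT i c).1 N) (pow_nonneg hy _))
  rw [headGF]
  refine hlim.congr fun N => ?_
  rw [headGFN_eq_sum_headCoeffN, tsum_eq_sum (s := Finset.range (N + 2)) (fun i hi => by
    rw [mem_range, not_lt] at hi
    rw [(headCoeffN_eq_zero_of_lt hi c c).1, zero_mul])]

/-- ★ `G^{(N)}_e(y_T) → G_e = HV.tailGF T e` (`T ≥ 2`). [cite: BeatonBousquetMelouDeGierDuminilCopinGuttmann2014, §3.2 and Corollary 8; lane «pcv-sawmu» a-p2 g22] -/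
theorem tendsto_tailGFN_tailGF (hT : 2 ≤ T) (e : ℤ) : Tendsto (fun N => tailGFN T N e (stripYT T)) atTop (𝓝 (tailGF T e)) := by
  have hy : 0 ≤ stripYT T := (one_lt_stripYT (by omega : 1 ≤ T)).le.trans' zero_le_one
  obtain ⟨hsum, -⟩ := summable_tailCoeff_mul_pow hT e
  have hlim := tendsto_tsum_of_dominated_convergence (𝓕 := atTop) (β := ℕ)
    (f := fun (N k : ℕ) => tailCoeffN T N k e * stripYT T ^ k) (g := fun k => tailCoeff T k e * stripYT T ^ k)
    (bound := fun k => tailCoeff T k e * stripYT T ^ k) hsum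
    (fun k => ((tailCoeffN_le_tendsto hT k e).2.2).mul_const _)
    (Eventually.of_forall fun N k => by
      rw [Real.norm_eq_abs, abs_of_nonneg (mul_nonneg (pieceCoeffN_nonneg N k e e).2.2 (pow_nonneg hy _))]
      exact mul_le_mul_of_nonneg_right ((tailCoeffN_le_tendsto hT k e).1 N) (pow_nonneg hy _))
  rw [tailGF]
  refine hlim.congr fun N => ?_
  rw [tailGFN_eq_sum_tailCoeffN, tsum_eq_sum (s := Finset.range (N + 2)) (fun k hk => by
    rw [mem_range, not_lt] at hk
    rw [(headCoeffN_eq_zero_of_lt hk e e).2, zero_mul])]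

/-- ★★ **`Fℓ_c = F_c` and `Gℓ_e = G_e`** (`T ≥ 2`): the length-summed and the contact-summed head (tail) series of the infinite strip at the threshold
are the same number — the total `x_c^{|h|} y_T^{#top}`-mass of the heads (tails) —, both being the limit of the truncated series.
[cite: BeatonBousquetMelouDeGierDuminilCopinGuttmann2014, §3.2 and Corollary 8; lane «pcv-sawmu» a-p2 g22 — own] -/
theorem headLenGF_eq_headGF (hT : 2 ≤ T) (c e : ℤ) : headLenGF T c = headGF T c ∧ tailLenGF T e = tailGF T e :=
  ⟨tendsto_nhds_unique (tendsto_headGFN_headLenGF hT c) (tendsto_headGFN_headGF hT c),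
    tendsto_nhds_unique (tendsto_tailGFN_tailLenGF hT e) (tendsto_tailGFN_tailGF hT e)⟩

/-- ★★ **The length law on the contact-law masses** (`T ≥ 2`): with positive bridge data `u′, ℓ′, ρ′` (the parity-class length law, restated),
`bℓ_T(2m)(y_T) → 4ρ′ · (Σ_a F_a u′_a) · (Σ_b ℓ′_b G_b)` where `F_a = HV.headGF T a`, `G_b = HV.tailGF T b` are EXACTLY the head/tail series of the contact
law `β_{T,m} y_T^m → (2ρ/y_T)(Σ_a F_a u_a)(Σ_b ℓ_b G_b)` (#495): the two amplitudes differ only through the bridge residues.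
[cite: BeatonBousquetMelouDeGierDuminilCopinGuttmann2014, §3.2 and Corollary 8; DuminilCopinHammond2013, §2.2; lane «pcv-sawmu» a-p2 g22 — own] -/
theorem exists_tendsto_betaLenSum_even_headGF (hT : 2 ≤ T) :
    ∃ (u ℓ : Fin (2 * T) → ℝ) (ρ : ℝ), (∀ a, 0 < u a) ∧ (∀ b, 0 < ℓ b) ∧ 0 < ρ ∧
      (∀ a b, Tendsto (fun k : ℕ => LUM T (2 * k + 1) (2 * (k : ℤ) + lchi a - lchi b) (stripYT T) a b) atTop
        (𝓝 (2 * (ρ * (u a * ℓ b))))) ∧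
      Tendsto (fun m : ℕ => betaLenSum T (2 * m) (stripYT T)) atTop
        (𝓝 (4 * ρ * (∑ a : Fin (2 * T), headGF T (a : ℕ) * u a) * (∑ b : Fin (2 * T), ℓ b * tailGF T (b : ℕ)))) := by
  obtain ⟨u, ℓ, ρ, hu, hℓ, hρ, hlaw, hlim⟩ := exists_tendsto_betaLenSum_even hT
  refine ⟨u, ℓ, ρ, hu, hℓ, hρ, hlaw, ?_⟩
  have hF : ∀ a : Fin (2 * T), headLenGF T (a : ℕ) = headGF T (a : ℕ) := fun a => (headLenGF_eq_headGF hT _ (0 : ℤ)).1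
  have hG : ∀ b : Fin (2 * T), tailLenGF T (b : ℕ) = tailGF T (b : ℕ) := fun b => (headLenGF_eq_headGF hT (0 : ℤ) _).2
  simp only [← hF, ← hG]
  exact hlim

end Literature.Probability.RandomPlanarGeometry.SAW.HV
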